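/-
Copyright: the b2b-balaban T⁴-continuum CRUX team, row NE7b leaf lineage `t4-ne7b-formalise-leaf-01` (gen 82). Project licence.
-/
import Mathlib.Analysis.Calculus.ContDiff.Operations
import Mathlib.Analysis.Calculus.FDeriv.CompCLM
import Mathlib.Analysis.Calculus.MeanValue
import Mathlib.Analysis.SpecialFunctions.Log.Basic
import Mathlib.MeasureTheory.Function.Jacobian
import Literature.Geometry.Riemannian.MeanConvexSecondChainRule

/-!
# THE NONLINEAR CHART: the transport of the road's HESSIAN letters through a `C²` change of variables, with the explicit CHART TERM
# `DV(φ x)(D²φ(x)[v, v])` of the exponent and the log-Jacobian term of the measure — modulus `λ ↦ μ²λ − g·q − j`, exact pull-back at a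
# critical point, no chart term for affine charts (row NE7b, node U5c; residual (R2′) family (2), letter (ℓ1) in HESSIAN currency;
# kernel lemmas of calculus ∕ measure theory)

Cell `pub-balaban`, sub-cell `t4`, spine estimate NE7b (`T4WeightBudget.RelWeightBound`; the cell's OWN estimate — NOT PRINTED in
[Bałaban 1983–89], NOT PROVED).  Crux-route work under `Spine/NE7b/` by a row leaf on the OWNER's windowed convexity road; NOTHING of
Bałaban's is named or asserted; no `T4Continuum/Support` leaf typed; no `def`; zero `sorry`.  Imports: Mathlib + ONE built Literature
module (`Literature.Geometry.Riemannian.MeanConvexSecondChainRule`, hub olean 2026-08-15) — independent of the `Spine/NE7b` olean frontier.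

WHY.  The pricing desk's standing debt on the fund route R-P1 (PRICING-NE7b v101 §3¹⁰¹ (ii), v102 §3¹⁰²: «THE CHART»): print's
fluctuation windows are PRODUCTS only in the minimiser-adapted NONLINEAR chart ([III] CMP 119 (1.8); [B15] CMP 122 (1.22), (1.26)–(1.27),
(1.29)); there the typed product-window road applies verbatim «at the cost of the chart term `DA_k·D²chart` in every Hessian letter».  The
tree transports the modulus letter through LINEAR maps only (`…ConvexityModulusTransport`).  THIS FILE types the NONLINEAR step with the
tree's second-order chain rule `D²(V ∘ φ)(x)[v, w] = D²V(φ x)[Dφ(x)v, Dφ(x)w] + DV(φ x)(D²φ(x)[v, w])` (Cartan 1967 I.5.4.2, BY NAME): a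
Hessian letter with a form `Q` pulls back along `Dφ(x)` minus the chart term `‖DV(φ x)‖·‖D²φ(x)‖·‖v‖²` (§1–§2; scalar letters: modulus
`μ²λ − g·q`, growth `Λm² + g·q`); the fluctuation MEASURE adds the log-Jacobian to the exponent (§5; full letter `μ²λ − g·q − j`); the
gradient letter `g` is NOT new — near a centre `y₀` with `‖DV(y₀)‖ ≤ g₀` and `‖D²V‖ ≤ L`, `g ≤ g₀ + L·r` on a window of radius `r` (§6:
modulus `μ²λ − (g₀ + L·r)·q`, in scalar and in FORM currency — the latter is the carrier for gauge-covariant actions, v103 R-HCT-g82-1);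
at a critical centre and for affine charts the pull-back is exact (§3–§4).

WHAT IS PROVED ([folklore]; the tree's `Literature.Geometry.Riemannian.iteratedFDeriv_two_comp_apply` BY NAME, not restated; pointwise
hypotheses `ContDiffAt ℝ 2 V (φ x)`, `ContDiffAt ℝ 2 φ x`):
* §1 `abs_chartTerm_le` (`|DV(φ x)(D²φ(x)[v, w])| ≤ ‖DV(φ x)‖·‖D²φ(x)‖·‖v‖·‖w‖`).
* §2 (real-valued `V`) **`hessian_comp_lower_of_form`** ∕ `…upper_of_form` (letters with ANY functional `Q` ∕ `R` at the image point pull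
  back along `Dφ(x)` up to `∓` the chart term), **`hessian_comp_lower_of_letters`** (`(λμ² − g·q)‖v‖² ≤ D²(V ∘ φ)(x)[v, v]`),
  `…upper_of_letters` (`≤ (Λm² + g·q)‖v‖²`), window forms on `MapsTo φ K' K`: **`hessianOn_comp_lower_of_form`** (block form `Q`:
  `2·(Q(Dφ(x)v) − (g·q∕2)‖v‖²) ≤ D²(V ∘ φ)(x)[v, v]` on `K'`), `hessianOn_comp_lower_of_letters` ∕ `hessianOn_comp_twoSided_of_letters`
  (output = the `hH` ∕ `hlo`–`hup` hypothesis shape of `…HessianFormFirstOrder` §1–§2 for `V ∘ φ` on `K'`, `Q := ((λμ² − g·q)∕2)‖·‖²`).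
* §3 `iteratedFDeriv_two_comp_apply_of_fderiv_eq_zero` (critical image point: exact pull-back), `hessian_comp_lower_of_letters_crit` (`μ²λ`).
* §4 `iteratedFDeriv_two_affine`, `iteratedFDeriv_two_comp_affine_apply` (affine chart: `D²(V ∘ φ)(x)[v, w] = D²V(T x + b)[T v, T w]`).
* §5 THE MEASURE's chart term (finite dimension, Haar `μ`): **`setIntegral_exp_neg_image_eq_chartExponent`** — injective chart of a
  measurable window, non-degenerate Jacobian: `∫_{φ(K')} e^{−V} dμ = ∫_{K'} e^{−(V∘φ − log|det φ'|)} dμ` (Mathlib's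
  `integral_image_eq_integral_abs_det_fderiv_smul` BY NAME); `hessian_sub_lower_of_forms` (`2·Q ≤ D²W`, `D²J ≤ 2·R` ⟹ `2·(Q − R) ≤ D²(W − J)`;
  by-value instance in the tree for the exponential cube chart of `SU(2)^s`: `…T4CubeChartExpHessian.hessianBoundOn_expJacRep` — the
  log-Jacobian term ADDS `(2∕3)(v ⬝ᵥ v)`), `hessian_sub_lower_of_letters`, **`hessian_chartExponent_lower_of_letters`** (the FULL chart letter
  `(λμ² − g·q − j)‖v‖² ≤ D²(V∘φ − J)(x)[v, v]`, `j` = the displayed semiconcavity letter of the log-Jacobian `J`, not derived here).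
* §6 **the gradient letter from the WINDOW RADIUS**: `norm_fderiv_le_of_norm_iteratedFDeriv_two_le` (`‖DV(y)‖ ≤
  ‖DV(y₀)‖ + L‖y − y₀‖` on a convex window with `‖D²V‖ ≤ L`, Mathlib's mean value inequality BY NAME), **`hessianOn_comp_lower_near`**
  (`‖DV(y₀)‖ ≤ g₀`, `φ(K') ⊆ K ∩ B̄(y₀, r)` ⟹ `(λμ² − (g₀ + L·r)·q)‖v‖²` on `K'`), `hessianOn_comp_lower_near_crit` (`g₀ = 0`:
  `(λμ² − L·q·r)‖v‖²`), **`hessianOn_comp_lower_near_of_form`** (FORM currency: `2·Q(Dφ(x)v) − (g₀ + L·r)·q·‖v‖² ≤ D²(V∘φ)(x)[v, v]`).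
* §7 a kernel toy: the letters are ATTAINED (`V y = (λ∕2)y² + g·y`, `φ t = μt − (q∕2)t²`: the `t²`-coefficient of `V ∘ φ` is `(λμ² − g·q)∕2`).

NOT HERE (honest): which chart print uses at which step and the VALUES of `μ, m, q, j` and of the window radius `r` for it; the
two-sided display `λ, L` itself ((A3) ∕ (A1c) — NC-NE7b-α UNRULED; §6 only says no FURTHER letter is needed); that print's log-Jacobian
is `C²` with the letter `j` (for the gauge-covariant charts of [III] (1.8) ∕ [B15] (1.22) this is a statement about third derivatives of the
group exponential ∕ the axial-gauge section — not typed); anything of Bałaban's.  BY-NAME EFFECT ON THE WALL: NONE (bookkeeping of a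
letter).  NE7b NOT PRINTED ∕ NOT PROVED; spine PROVED 0∕9; rung (B)+1 on a FINITE torus — NOT infinite volume, NOT the mass gap, NOT Clay.
HONEST DEPENDENCY: continuum YM on T⁴ ⇐ BetaPertH ∧ nine spine estimates (0/9 proved); BetaPertH ⇐ (D1) ∧ (D4) ∧ CAP+tail; G-an2-4
gates asym, D1 and NE2/3/4.
-/

set_option autoImplicit false

open Set Filter Topology

namespace Summit.QuantumFields.BalabanUV.T4Continuum.NE7b.HessianChartTransport

open Literature.Geometry.Riemannian (iteratedFDeriv_two_comp_apply)

/-! ## §1 The chart term of the second-order chain rule `D²(V ∘ φ)(x)[v, w] = D²V(φ x)[Dφ v, Dφ w] + DV(φ x)(D²φ(x)[v, w])`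
(`Literature.Geometry.Riemannian.iteratedFDeriv_two_comp_apply`, BY NAME) -/

section ChainRule

variable {E F G : Type*} [NormedAddCommGroup E] [NormedSpace ℝ E] [NormedAddCommGroup F] [NormedSpace ℝ F]
  [NormedAddCommGroup G] [NormedSpace ℝ G]

/-- **THE CHART TERM IS A FIRST-DERIVATIVE SMALLNESS** (real-valued outer function): `|DV(φ x)(D²φ(x)[v, w])| ≤
‖DV(φ x)‖·‖D²φ(x)‖·‖v‖·‖w‖` — operator norms only. [folklore] -/
theorem abs_chartTerm_le (V : F → ℝ) (φ : E → F) (x v w : E) :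
    |fderiv ℝ V (φ x) (iteratedFDeriv ℝ 2 φ x ![v, w])| ≤ ‖fderiv ℝ V (φ x)‖ * ‖iteratedFDeriv ℝ 2 φ x‖ * ‖v‖ * ‖w‖ := by
  rw [← Real.norm_eq_abs]
  calc ‖fderiv ℝ V (φ x) (iteratedFDeriv ℝ 2 φ x ![v, w])‖
      ≤ ‖fderiv ℝ V (φ x)‖ * ‖iteratedFDeriv ℝ 2 φ x ![v, w]‖ := ContinuousLinearMap.le_opNorm _ _
    _ ≤ ‖fderiv ℝ V (φ x)‖ * (‖iteratedFDeriv ℝ 2 φ x‖ * (‖v‖ * ‖w‖)) := by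
        gcongr
        have h := (iteratedFDeriv ℝ 2 φ x).le_opNorm ![v, w]
        simpa [Fin.prod_univ_two] using h
    _ = ‖fderiv ℝ V (φ x)‖ * ‖iteratedFDeriv ℝ 2 φ x‖ * ‖v‖ * ‖w‖ := by ring

end ChainRule

/-! ## §2 Transport of the Hessian letters through the chart, with the chart term -/

section Transport

variable {E F : Type*} [NormedAddCommGroup E] [NormedSpace ℝ E] [NormedAddCommGroup F] [NormedSpace ℝ F]

/-- **LOWER LETTER WITH A FORM, PULLED BACK**: `2·Q(w) ≤ D²V(φ x)[w, w]` for every `w` (`Q` ANY functional — block ∕ Schur forms) ⟹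
`2·Q(Dφ(x) v) − ‖DV(φ x)‖·‖D²φ(x)‖·‖v‖² ≤ D²(V ∘ φ)(x)[v, v]`: the form pulls back along `Dφ(x)`, the chart term is subtracted. [folklore] -/
theorem hessian_comp_lower_of_form {V : F → ℝ} {φ : E → F} {x : E} (hV : ContDiffAt ℝ 2 V (φ x)) (hφ : ContDiffAt ℝ 2 φ x)
    (Q : F → ℝ) (hH : ∀ w : F, 2 * Q w ≤ iteratedFDeriv ℝ 2 V (φ x) ![w, w]) (v : E) :
    2 * Q (fderiv ℝ φ x v) - ‖fderiv ℝ V (φ x)‖ * ‖iteratedFDeriv ℝ 2 φ x‖ * ‖v‖ ^ 2 ≤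
      iteratedFDeriv ℝ 2 (V ∘ φ) x ![v, v] := by
  rw [iteratedFDeriv_two_comp_apply hφ hV]
  have h1 := hH (fderiv ℝ φ x v)
  have h2 := abs_chartTerm_le V φ x v v
  rw [abs_le] at h2
  nlinarith [h2.1]

/-- **UPPER LETTER WITH A FORM, PULLED BACK.**  If `D²V(φ x)[w, w] ≤ 2·R(w)` for every `w`, then
`D²(V ∘ φ)(x)[v, v] ≤ 2·R(Dφ(x) v) + ‖DV(φ x)‖·‖D²φ(x)‖·‖v‖²`. [folklore] -/
theorem hessian_comp_upper_of_form {V : F → ℝ} {φ : E → F} {x : E} (hV : ContDiffAt ℝ 2 V (φ x)) (hφ : ContDiffAt ℝ 2 φ x)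
    (R : F → ℝ) (hH : ∀ w : F, iteratedFDeriv ℝ 2 V (φ x) ![w, w] ≤ 2 * R w) (v : E) :
    iteratedFDeriv ℝ 2 (V ∘ φ) x ![v, v] ≤
      2 * R (fderiv ℝ φ x v) + ‖fderiv ℝ V (φ x)‖ * ‖iteratedFDeriv ℝ 2 φ x‖ * ‖v‖ ^ 2 := by
  rw [iteratedFDeriv_two_comp_apply hφ hV]
  have h1 := hH (fderiv ℝ φ x v)
  have h2 := abs_chartTerm_le V φ x v v
  rw [abs_le] at h2
  nlinarith [h2.2]

/-- **THE MODULUS THROUGH A NONLINEAR CHART: `λ ↦ μ²λ − g·q`** from `λ‖w‖² ≤ D²V(φ x)[w, w]` (`0 ≤ λ`), `μ‖v‖ ≤ ‖Dφ(x) v‖` (`0 ≤ μ`),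
`‖DV(φ x)‖ ≤ g` (gradient smallness at the image point), `‖D²φ(x)‖ ≤ q` (chart curvature). [folklore] -/
theorem hessian_comp_lower_of_letters {V : F → ℝ} {φ : E → F} {x : E} (hV : ContDiffAt ℝ 2 V (φ x)) (hφ : ContDiffAt ℝ 2 φ x)
    {lam μ g q : ℝ} (hlam : 0 ≤ lam) (hμ : 0 ≤ μ)
    (hH : ∀ w : F, lam * ‖w‖ ^ 2 ≤ iteratedFDeriv ℝ 2 V (φ x) ![w, w])
    (hlow : ∀ v : E, μ * ‖v‖ ≤ ‖fderiv ℝ φ x v‖) (hg : ‖fderiv ℝ V (φ x)‖ ≤ g) (hq : ‖iteratedFDeriv ℝ 2 φ x‖ ≤ q) (v : E) :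
    (lam * μ ^ 2 - g * q) * ‖v‖ ^ 2 ≤ iteratedFDeriv ℝ 2 (V ∘ φ) x ![v, v] := by
  have hH' : ∀ w : F, 2 * (lam / 2 * ‖w‖ ^ 2) ≤ iteratedFDeriv ℝ 2 V (φ x) ![w, w] := fun w => by linarith [hH w]
  have key := hessian_comp_lower_of_form hV hφ (fun w => lam / 2 * ‖w‖ ^ 2) hH' v
  have hsq : (μ * ‖v‖) ^ 2 ≤ ‖fderiv ℝ φ x v‖ ^ 2 := pow_le_pow_left₀ (mul_nonneg hμ (norm_nonneg v)) (hlow v) 2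
  have hA : lam * (μ * ‖v‖) ^ 2 ≤ lam * ‖fderiv ℝ φ x v‖ ^ 2 := mul_le_mul_of_nonneg_left hsq hlam
  have hg0 : 0 ≤ g := (norm_nonneg _).trans hg
  have hB : ‖fderiv ℝ V (φ x)‖ * ‖iteratedFDeriv ℝ 2 φ x‖ * ‖v‖ ^ 2 ≤ g * q * ‖v‖ ^ 2 := by
    have := mul_le_mul hg hq (norm_nonneg _) hg0
    exact mul_le_mul_of_nonneg_right this (sq_nonneg _)
  nlinarith [hA, hB, key]

/-- **THE GROWTH THROUGH A NONLINEAR CHART: `Λ ↦ Λm² + g·q`** from `D²V(φ x)[w, w] ≤ Λ‖w‖²` (`0 ≤ Λ`), `‖Dφ(x)‖ ≤ m`, `g`, `q`. [folklore] -/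
theorem hessian_comp_upper_of_letters {V : F → ℝ} {φ : E → F} {x : E} (hV : ContDiffAt ℝ 2 V (φ x)) (hφ : ContDiffAt ℝ 2 φ x)
    {Lam m g q : ℝ} (hLam : 0 ≤ Lam)
    (hH : ∀ w : F, iteratedFDeriv ℝ 2 V (φ x) ![w, w] ≤ Lam * ‖w‖ ^ 2)
    (hm : ‖fderiv ℝ φ x‖ ≤ m) (hg : ‖fderiv ℝ V (φ x)‖ ≤ g) (hq : ‖iteratedFDeriv ℝ 2 φ x‖ ≤ q) (v : E) :
    iteratedFDeriv ℝ 2 (V ∘ φ) x ![v, v] ≤ (Lam * m ^ 2 + g * q) * ‖v‖ ^ 2 := by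
  have hH' : ∀ w : F, iteratedFDeriv ℝ 2 V (φ x) ![w, w] ≤ 2 * (Lam / 2 * ‖w‖ ^ 2) := fun w => by linarith [hH w]
  have key := hessian_comp_upper_of_form hV hφ (fun w => Lam / 2 * ‖w‖ ^ 2) hH' v
  have hm0 : 0 ≤ m := (norm_nonneg _).trans hm
  have hDφ : ‖fderiv ℝ φ x v‖ ≤ m * ‖v‖ := (ContinuousLinearMap.le_opNorm _ _).trans (mul_le_mul_of_nonneg_right hm (norm_nonneg _))
  have hsq : ‖fderiv ℝ φ x v‖ ^ 2 ≤ (m * ‖v‖) ^ 2 := pow_le_pow_left₀ (norm_nonneg _) hDφ 2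
  have hA : Lam * ‖fderiv ℝ φ x v‖ ^ 2 ≤ Lam * (m * ‖v‖) ^ 2 := mul_le_mul_of_nonneg_left hsq hLam
  have hg0 : 0 ≤ g := (norm_nonneg _).trans hg
  have hB : ‖fderiv ℝ V (φ x)‖ * ‖iteratedFDeriv ℝ 2 φ x‖ * ‖v‖ ^ 2 ≤ g * q * ‖v‖ ^ 2 := by
    have := mul_le_mul hg hq (norm_nonneg _) hg0
    exact mul_le_mul_of_nonneg_right this (sq_nonneg _)
  nlinarith [hA, hB, key]

/-- **WINDOW FORM WITH A FORM** (the product-window road's currency): `2·Q(w) ≤ D²V(y)[w, w]` on `K`, `φ(K') ⊆ K`, `‖DV‖ ≤ g` on `φ(K')`,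
`‖D²φ‖ ≤ q` on `K'` ⟹ `2·(Q(Dφ(x) v) − (g·q∕2)‖v‖²) ≤ D²(V ∘ φ)(x)[v, v]` on `K'`. [folklore] -/
theorem hessianOn_comp_lower_of_form {V : F → ℝ} {φ : E → F} {K : Set F} {K' : Set E} (hφK : MapsTo φ K' K)
    (hV : ∀ x ∈ K', ContDiffAt ℝ 2 V (φ x)) (hφ : ∀ x ∈ K', ContDiffAt ℝ 2 φ x) (Q : F → ℝ) {g q : ℝ}
    (hH : ∀ y ∈ K, ∀ w : F, 2 * Q w ≤ iteratedFDeriv ℝ 2 V y ![w, w])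
    (hg : ∀ x ∈ K', ‖fderiv ℝ V (φ x)‖ ≤ g) (hq : ∀ x ∈ K', ‖iteratedFDeriv ℝ 2 φ x‖ ≤ q) :
    ∀ x ∈ K', ∀ v : E, 2 * (Q (fderiv ℝ φ x v) - g * q / 2 * ‖v‖ ^ 2) ≤ iteratedFDeriv ℝ 2 (V ∘ φ) x ![v, v] := by
  intro x hx v
  have hB := mul_le_mul_of_nonneg_right (mul_le_mul (hg x hx) (hq x hx) (norm_nonneg _) ((norm_nonneg _).trans (hg x hx))) (sq_nonneg ‖v‖)
  linarith [hessian_comp_lower_of_form (hV x hx) (hφ x hx) Q (hH (φ x) (hφK hx)) v]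

/-- **WINDOW FORM, LOWER** — verbatim the `hH` hypothesis of `…HessianFormFirstOrder` §1–§2 for `V ∘ φ` on the chart window `K'`, with
`Q := ((λμ² − g·q)∕2)‖·‖²`. [folklore] -/
theorem hessianOn_comp_lower_of_letters {V : F → ℝ} {φ : E → F} {K : Set F} {K' : Set E} (hφK : MapsTo φ K' K)
    (hV : ∀ x ∈ K', ContDiffAt ℝ 2 V (φ x)) (hφ : ∀ x ∈ K', ContDiffAt ℝ 2 φ x)
    {lam μ g q : ℝ} (hlam : 0 ≤ lam) (hμ : 0 ≤ μ)
    (hH : ∀ y ∈ K, ∀ w : F, lam * ‖w‖ ^ 2 ≤ iteratedFDeriv ℝ 2 V y ![w, w])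
    (hlow : ∀ x ∈ K', ∀ v : E, μ * ‖v‖ ≤ ‖fderiv ℝ φ x v‖) (hg : ∀ x ∈ K', ‖fderiv ℝ V (φ x)‖ ≤ g)
    (hq : ∀ x ∈ K', ‖iteratedFDeriv ℝ 2 φ x‖ ≤ q) :
    ∀ x ∈ K', ∀ v : E, 2 * ((lam * μ ^ 2 - g * q) / 2 * ‖v‖ ^ 2) ≤ iteratedFDeriv ℝ 2 (V ∘ φ) x ![v, v] := by
  intro x hx v
  have := hessian_comp_lower_of_letters (hV x hx) (hφ x hx) hlam hμ (hH (φ x) (hφK hx)) (hlow x hx) (hg x hx) (hq x hx) v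
  linarith

/-- **WINDOW FORM, TWO-SIDED**: `(λμ² − g·q)‖v‖² ≤ D²(V ∘ φ)(x)[v, v] ≤ (Λm² + g·q)‖v‖²` on `K'` (HFFO's `hlo` ∕ `hup` content). [folklore] -/
theorem hessianOn_comp_twoSided_of_letters {V : F → ℝ} {φ : E → F} {K : Set F} {K' : Set E} (hφK : MapsTo φ K' K)
    (hV : ∀ x ∈ K', ContDiffAt ℝ 2 V (φ x)) (hφ : ∀ x ∈ K', ContDiffAt ℝ 2 φ x)
    {lam Lam μ m g q : ℝ} (hlam : 0 ≤ lam) (hLam : 0 ≤ Lam) (hμ : 0 ≤ μ)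
    (hlo : ∀ y ∈ K, ∀ w : F, lam * ‖w‖ ^ 2 ≤ iteratedFDeriv ℝ 2 V y ![w, w])
    (hup : ∀ y ∈ K, ∀ w : F, iteratedFDeriv ℝ 2 V y ![w, w] ≤ Lam * ‖w‖ ^ 2)
    (hlow : ∀ x ∈ K', ∀ v : E, μ * ‖v‖ ≤ ‖fderiv ℝ φ x v‖) (hm : ∀ x ∈ K', ‖fderiv ℝ φ x‖ ≤ m)
    (hg : ∀ x ∈ K', ‖fderiv ℝ V (φ x)‖ ≤ g) (hq : ∀ x ∈ K', ‖iteratedFDeriv ℝ 2 φ x‖ ≤ q) :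
    ∀ x ∈ K', ∀ v : E, (lam * μ ^ 2 - g * q) * ‖v‖ ^ 2 ≤ iteratedFDeriv ℝ 2 (V ∘ φ) x ![v, v] ∧
      iteratedFDeriv ℝ 2 (V ∘ φ) x ![v, v] ≤ (Lam * m ^ 2 + g * q) * ‖v‖ ^ 2 :=
  fun x hx v =>
    ⟨hessian_comp_lower_of_letters (hV x hx) (hφ x hx) hlam hμ (hlo (φ x) (hφK hx)) (hlow x hx) (hg x hx) (hq x hx) v,
      hessian_comp_upper_of_letters (hV x hx) (hφ x hx) hLam (hup (φ x) (hφK hx)) (hm x hx) (hg x hx) (hq x hx) v⟩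

end Transport

/-! ## §3 At a critical point of `V` the pull-back is exact (the chart centred at the minimiser) -/

section Critical

variable {E F G : Type*} [NormedAddCommGroup E] [NormedSpace ℝ E] [NormedAddCommGroup F] [NormedSpace ℝ F]
  [NormedAddCommGroup G] [NormedSpace ℝ G]

/-- **EXACT PULL-BACK AT A CRITICAL IMAGE POINT**: if `DV(φ x) = 0` then `D²(V ∘ φ)(x)[v, w] = D²V(φ x)[Dφ(x) v, Dφ(x) w]` — no chart
term, whatever the curvature of the chart. [folklore] -/
theorem iteratedFDeriv_two_comp_apply_of_fderiv_eq_zero {V : F → G} {φ : E → F} {x : E} (hV : ContDiffAt ℝ 2 V (φ x))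
    (hφ : ContDiffAt ℝ 2 φ x) (hcrit : fderiv ℝ V (φ x) = 0) (v w : E) :
    iteratedFDeriv ℝ 2 (V ∘ φ) x ![v, w] = iteratedFDeriv ℝ 2 V (φ x) ![fderiv ℝ φ x v, fderiv ℝ φ x w] := by
  rw [iteratedFDeriv_two_comp_apply hφ hV, hcrit, zero_apply, add_zero]

/-- **THE MODULUS AT A CRITICAL IMAGE POINT: `λ ↦ μ²λ`, no loss** (the linear rule of `…ConvexityModulusTransport` §1, now for a
nonlinear chart at the one point where it is centred). [folklore] -/
theorem hessian_comp_lower_of_letters_crit {V : F → ℝ} {φ : E → F} {x : E} (hV : ContDiffAt ℝ 2 V (φ x))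
    (hφ : ContDiffAt ℝ 2 φ x) (hcrit : fderiv ℝ V (φ x) = 0) {lam μ : ℝ} (hlam : 0 ≤ lam) (hμ : 0 ≤ μ)
    (hH : ∀ w : F, lam * ‖w‖ ^ 2 ≤ iteratedFDeriv ℝ 2 V (φ x) ![w, w]) (hlow : ∀ v : E, μ * ‖v‖ ≤ ‖fderiv ℝ φ x v‖) (v : E) :
    lam * μ ^ 2 * ‖v‖ ^ 2 ≤ iteratedFDeriv ℝ 2 (V ∘ φ) x ![v, v] := by
  rw [iteratedFDeriv_two_comp_apply_of_fderiv_eq_zero hV hφ hcrit]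
  have hsq : (μ * ‖v‖) ^ 2 ≤ ‖fderiv ℝ φ x v‖ ^ 2 :=
    pow_le_pow_left₀ (mul_nonneg hμ (norm_nonneg v)) (hlow v) 2
  have hA : lam * (μ * ‖v‖) ^ 2 ≤ lam * ‖fderiv ℝ φ x v‖ ^ 2 := mul_le_mul_of_nonneg_left hsq hlam
  nlinarith [hH (fderiv ℝ φ x v), hA]

end Critical

/-! ## §4 Affine charts have no chart term -/

section Affine

variable {E F G : Type*} [NormedAddCommGroup E] [NormedSpace ℝ E] [NormedAddCommGroup F] [NormedSpace ℝ F]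
  [NormedAddCommGroup G] [NormedSpace ℝ G]

/-- The second derivative of an affine chart `y ↦ T y + b` vanishes. [folklore] -/
theorem iteratedFDeriv_two_affine (T : E →L[ℝ] F) (b : F) (x : E) :
    iteratedFDeriv ℝ 2 (fun y => T y + b) x = 0 := by
  ext m
  rw [iteratedFDeriv_two_apply]
  have hD : fderiv ℝ (fun y => T y + b) = fun _ => T := by funext y; rw [fderiv_add_const]; exact T.fderiv
  rw [hD, fderiv_const_apply]
  rfl

/-- **AFFINE CHART: EXACT PULL-BACK EVERYWHERE** — `D²(V ∘ (T· + b))(x)[v, w] = D²V(T x + b)[T v, T w]` for `V` `C²` at `T x + b`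
(the Hessian-currency companion of `…ConvexityModulusTransport.strongConvexOn_comp_linearMap_of_bound_below`). [folklore] -/
theorem iteratedFDeriv_two_comp_affine_apply {V : F → G} (T : E →L[ℝ] F) (b : F) {x : E}
    (hV : ContDiffAt ℝ 2 V (T x + b)) (v w : E) :
    iteratedFDeriv ℝ 2 (V ∘ fun y => T y + b) x ![v, w] = iteratedFDeriv ℝ 2 V (T x + b) ![T v, T w] := by
  have hT : ContDiffAt ℝ 2 (fun y => T y) x := T.contDiff.contDiffAt
  have hφ : ContDiffAt ℝ 2 (fun y => T y + b) x := hT.add contDiffAt_const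
  have hD : fderiv ℝ (fun y => T y + b) x = T := by rw [fderiv_add_const]; exact T.fderiv
  have key := iteratedFDeriv_two_comp_apply (Φ := V) (ψ := fun y => T y + b) (x := x) hφ hV v w
  rw [key, iteratedFDeriv_two_affine, hD, zero_apply, map_zero, add_zero]

end Affine

/-! ## §5 The MEASURE's chart term: the windowed partition function in the chart has exponent `V ∘ φ − log|det Dφ|` -/

section Jacobian

open MeasureTheory

variable {E : Type*} [NormedAddCommGroup E] [NormedSpace ℝ E] [FiniteDimensional ℝ E] [MeasurableSpace E] [BorelSpace E]
  (μ : Measure E) [μ.IsAddHaarMeasure]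

/-- **THE WINDOWED PARTITION FUNCTION IN THE CHART.**  For an injective chart `φ` of the chart window `K'` (measurable) with derivative
`φ'` within `K'` and non-degenerate Jacobian, `∫_{φ(K')} e^{−V} = ∫_{K'} e^{−(V∘φ − log|det φ'|)}`: in the chart the exponent is
`W := V ∘ φ − log|det φ'|` — the measure's chart term enters the EXPONENT as the log-Jacobian (Mathlib's change of variables
`integral_image_eq_integral_abs_det_fderiv_smul` BY NAME).  (The tree PACKAGES this shape for the group fibre as the hypothesis structure
`Literature…Balaban1983to89.T4CubeChartTransport.IsCubeImage` — weighted law `= φ_*(e^{−jac} 1_K dx)`, exponent `jac − H∘φ` —; here it is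
DERIVED for an injective `C¹` chart between copies of a finite-dimensional space.) [folklore] -/
theorem setIntegral_exp_neg_image_eq_chartExponent {V : E → ℝ} {φ : E → E} {φ' : E → E →L[ℝ] E} {K' : Set E}
    (hK' : MeasurableSet K') (hφ' : ∀ x ∈ K', HasFDerivWithinAt φ (φ' x) K' x) (hinj : InjOn φ K')
    (hdet : ∀ x ∈ K', (φ' x).det ≠ 0) :
    ∫ y in φ '' K', Real.exp (-V y) ∂μ = ∫ x in K', Real.exp (-(V (φ x) - Real.log |(φ' x).det|)) ∂μ := by
  rw [integral_image_eq_integral_abs_det_fderiv_smul μ hK' hφ' hinj]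
  refine setIntegral_congr_fun hK' fun x hx => ?_
  simp only [smul_eq_mul]
  rw [neg_sub, sub_eq_add_neg, Real.exp_add, Real.exp_log (abs_pos.mpr (hdet x hx))]

end Jacobian

section ChartExponent

variable {E F : Type*} [NormedAddCommGroup E] [NormedSpace ℝ E] [NormedAddCommGroup F] [NormedSpace ℝ F]

/-- **EXPONENT MINUS LOG-JACOBIAN, FORM CURRENCY.**  If `W` displays `2·Q(v) ≤ D²W(x)[v, v]` and the log-Jacobian `J` displays
`D²J(x)[v, v] ≤ 2·R(v)` (`Q`, `R` ANY functionals — e.g. the Euclidean forms `(c∕2)(v ⬝ᵥ v)` of the tree's `HessianBoundOn` currency on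
`Fin n → ℝ`, whose sup norm is not the road's `‖·‖²`), then `W − J` displays `2·(Q(v) − R(v)) ≤ D²(W − J)(x)[v, v]`.  By-value instance in
the tree: for the exponential cube chart of `SU(2)^s` the log-Jacobian is `J = −expJacRep` with `D²(expJacRep) ≥ (2∕3)(v ⬝ᵥ v)` on cubes
`3S'² < π²` (`Literature…Balaban1983to89.T4CubeChartExpHessian.hessianBoundOn_expJacRep`; there `…_expJacRep_add` is this lemma in that
currency): the measure's chart term is FAVOURABLE, `R = −(1∕3)(v ⬝ᵥ v)`. [folklore] -/
theorem hessian_sub_lower_of_forms {W J : E → ℝ} {x : E} (hW : ContDiffAt ℝ 2 W x) (hJ : ContDiffAt ℝ 2 J x) (Q R : E → ℝ)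
    (hWl : ∀ v : E, 2 * Q v ≤ iteratedFDeriv ℝ 2 W x ![v, v]) (hJu : ∀ v : E, iteratedFDeriv ℝ 2 J x ![v, v] ≤ 2 * R v) (v : E) :
    2 * (Q v - R v) ≤ iteratedFDeriv ℝ 2 (W - J) x ![v, v] := by
  rw [iteratedFDeriv_sub_apply hW hJ, sub_apply]
  linarith [hWl v, hJu v]

/-- **EXPONENT MINUS LOG-JACOBIAN: the moduli subtract.**  If `W` displays `a‖v‖² ≤ D²W(x)[v, v]` and the log-Jacobian `J` displays the
semiconcavity letter `D²J(x)[v, v] ≤ j‖v‖²` (a THIRD-derivative letter of the chart — displayed, not derived here), then the chart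
exponent `W − J` displays `(a − j)‖v‖² ≤ D²(W − J)(x)[v, v]`. [folklore] -/
theorem hessian_sub_lower_of_letters {W J : E → ℝ} {x : E} (hW : ContDiffAt ℝ 2 W x) (hJ : ContDiffAt ℝ 2 J x) {a j : ℝ}
    (hWl : ∀ v : E, a * ‖v‖ ^ 2 ≤ iteratedFDeriv ℝ 2 W x ![v, v]) (hJu : ∀ v : E, iteratedFDeriv ℝ 2 J x ![v, v] ≤ j * ‖v‖ ^ 2)
    (v : E) : (a - j) * ‖v‖ ^ 2 ≤ iteratedFDeriv ℝ 2 (W - J) x ![v, v] := by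
  rw [iteratedFDeriv_sub_apply hW hJ, sub_apply]
  linarith [hWl v, hJu v]

/-- **THE FULL CHART LETTER: `λ ↦ μ²λ − g·q − j`.**  The exponent of the windowed partition function in a nonlinear chart,
`V ∘ φ − J` with `J` the log-Jacobian (§5), has modulus `λμ² − g·q − j` at `x` from the six displayed letters: `λ` (the display on `V`),
`μ, q` (chart bounded below ∕ chart curvature), `g` (gradient smallness `‖DV(φ x)‖ ≤ g`), `j` (semiconcavity of the log-Jacobian). [folklore] -/
theorem hessian_chartExponent_lower_of_letters {V : F → ℝ} {φ : E → F} {J : E → ℝ} {x : E} (hV : ContDiffAt ℝ 2 V (φ x))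
    (hφ : ContDiffAt ℝ 2 φ x) (hJ : ContDiffAt ℝ 2 J x) {lam μ g q j : ℝ} (hlam : 0 ≤ lam) (hμ : 0 ≤ μ)
    (hH : ∀ w : F, lam * ‖w‖ ^ 2 ≤ iteratedFDeriv ℝ 2 V (φ x) ![w, w])
    (hlow : ∀ v : E, μ * ‖v‖ ≤ ‖fderiv ℝ φ x v‖) (hg : ‖fderiv ℝ V (φ x)‖ ≤ g) (hq : ‖iteratedFDeriv ℝ 2 φ x‖ ≤ q)
    (hJu : ∀ v : E, iteratedFDeriv ℝ 2 J x ![v, v] ≤ j * ‖v‖ ^ 2) (v : E) :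
    (lam * μ ^ 2 - g * q - j) * ‖v‖ ^ 2 ≤ iteratedFDeriv ℝ 2 (V ∘ φ - J) x ![v, v] :=
  hessian_sub_lower_of_letters (hV.comp x hφ) hJ
    (fun v => hessian_comp_lower_of_letters hV hφ hlam hμ hH hlow hg hq v) hJu v

end ChartExponent

/-! ## §6 The gradient letter FROM THE WINDOW RADIUS: near the minimiser `g ≤ L·r`, modulus `λμ² − L·q·r` -/

section NearMinimiser

variable {E F : Type*} [NormedAddCommGroup E] [NormedSpace ℝ E] [NormedAddCommGroup F] [NormedSpace ℝ F]

/-- **THE GRADIENT LETTER IS NOT A NEW LETTER**: on a convex window `K` where `V` is `C²` with `‖D²V‖ ≤ L`, the mean value inequality for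
`DV` gives `‖DV(y)‖ ≤ ‖DV(y₀)‖ + L·‖y − y₀‖` (`y₀, y ∈ K`); at a critical `y₀` the gradient letter is `g = L·r` on `K ∩ B̄(y₀, r)`. [folklore] -/
theorem norm_fderiv_le_of_norm_iteratedFDeriv_two_le {V : F → ℝ} {K : Set F} (hK : Convex ℝ K) (hV : ∀ y ∈ K, ContDiffAt ℝ 2 V y)
    {L : ℝ} (hL : ∀ y ∈ K, ‖iteratedFDeriv ℝ 2 V y‖ ≤ L) {y₀ y : F} (hy₀ : y₀ ∈ K) (hy : y ∈ K) :
    ‖fderiv ℝ V y‖ ≤ ‖fderiv ℝ V y₀‖ + L * ‖y - y₀‖ := by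
  have hmv : ‖fderiv ℝ V y - fderiv ℝ V y₀‖ ≤ L * ‖y - y₀‖ := by
    refine hK.norm_image_sub_le_of_norm_fderiv_le (f := fderiv ℝ V)
      (fun z hz => ((hV z hz).fderiv_right (m := 1) (by norm_num)).differentiableAt (by simp)) (fun z hz => ?_) hy₀ hy
    rw [← norm_iteratedFDeriv_one, norm_iteratedFDeriv_fderiv]
    exact hL z hz
  have := norm_le_insert' (fderiv ℝ V y) (fderiv ℝ V y₀)
  linarith

/-- **THE MODULUS NEAR ANY CENTRE: `λμ² − (g₀ + L·r)·q`** — `y₀ ∈ K` with `‖DV(y₀)‖ ≤ g₀` (print's background minimises UNDER A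
CONSTRAINT, so its ambient differential is a Lagrange multiplier, small not zero: PRICING-NE7b v103 R-HCT-g82-2), `‖D²V‖ ≤ L` on the convex
window `K`, `φ(K') ⊆ K ∩ B̄(y₀, r)`: the chart term costs (centre gradient + RADIUS × curvature) × chart curvature. [folklore] -/
theorem hessianOn_comp_lower_near {V : F → ℝ} {φ : E → F} {K : Set F} {K' : Set E} (hK : Convex ℝ K) (hφK : MapsTo φ K' K)
    (hV : ∀ y ∈ K, ContDiffAt ℝ 2 V y) (hφ : ∀ x ∈ K', ContDiffAt ℝ 2 φ x) {y₀ : F} (hy₀ : y₀ ∈ K)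
    {lam L μ q r g₀ : ℝ} (hlam : 0 ≤ lam) (hμ : 0 ≤ μ) (hg₀ : ‖fderiv ℝ V y₀‖ ≤ g₀)
    (hH : ∀ y ∈ K, ∀ w : F, lam * ‖w‖ ^ 2 ≤ iteratedFDeriv ℝ 2 V y ![w, w]) (hL : ∀ y ∈ K, ‖iteratedFDeriv ℝ 2 V y‖ ≤ L)
    (hlow : ∀ x ∈ K', ∀ v : E, μ * ‖v‖ ≤ ‖fderiv ℝ φ x v‖) (hq : ∀ x ∈ K', ‖iteratedFDeriv ℝ 2 φ x‖ ≤ q)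
    (hr : ∀ x ∈ K', ‖φ x - y₀‖ ≤ r) :
    ∀ x ∈ K', ∀ v : E, (lam * μ ^ 2 - (g₀ + L * r) * q) * ‖v‖ ^ 2 ≤ iteratedFDeriv ℝ 2 (V ∘ φ) x ![v, v] := by
  intro x hx v
  have hL0 : 0 ≤ L := (norm_nonneg _).trans (hL y₀ hy₀)
  have hg : ‖fderiv ℝ V (φ x)‖ ≤ g₀ + L * r := (norm_fderiv_le_of_norm_iteratedFDeriv_two_le hK hV hL hy₀ (hφK hx)).trans
    (add_le_add hg₀ (mul_le_mul_of_nonneg_left (hr x hx) hL0))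
  exact hessian_comp_lower_of_letters (hV (φ x) (hφK hx)) (hφ x hx) hlam hμ (hH (φ x) (hφK hx)) (hlow x hx) hg (hq x hx) v

/-- **AT A CRITICAL CENTRE: `λμ² − L·q·r`** (`g₀ = 0`): WINDOW RADIUS × curvatures, no gradient letter. [folklore] -/
theorem hessianOn_comp_lower_near_crit {V : F → ℝ} {φ : E → F} {K : Set F} {K' : Set E} (hK : Convex ℝ K) (hφK : MapsTo φ K' K)
    (hV : ∀ y ∈ K, ContDiffAt ℝ 2 V y) (hφ : ∀ x ∈ K', ContDiffAt ℝ 2 φ x) {y₀ : F} (hy₀ : y₀ ∈ K) (hcrit : fderiv ℝ V y₀ = 0)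
    {lam L μ q r : ℝ} (hlam : 0 ≤ lam) (hμ : 0 ≤ μ)
    (hH : ∀ y ∈ K, ∀ w : F, lam * ‖w‖ ^ 2 ≤ iteratedFDeriv ℝ 2 V y ![w, w]) (hL : ∀ y ∈ K, ‖iteratedFDeriv ℝ 2 V y‖ ≤ L)
    (hlow : ∀ x ∈ K', ∀ v : E, μ * ‖v‖ ≤ ‖fderiv ℝ φ x v‖) (hq : ∀ x ∈ K', ‖iteratedFDeriv ℝ 2 φ x‖ ≤ q)
    (hr : ∀ x ∈ K', ‖φ x - y₀‖ ≤ r) :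
    ∀ x ∈ K', ∀ v : E, (lam * μ ^ 2 - L * q * r) * ‖v‖ ^ 2 ≤ iteratedFDeriv ℝ 2 (V ∘ φ) x ![v, v] := by
  intro x hx v
  have h := hessianOn_comp_lower_near hK hφK hV hφ hy₀ hlam hμ (g₀ := 0) (by rw [hcrit, norm_zero]) hH hL hlow hq hr x hx v
  have e : (lam * μ ^ 2 - (0 + L * r) * q) * ‖v‖ ^ 2 = (lam * μ ^ 2 - L * q * r) * ‖v‖ ^ 2 := by ring
  linarith

/-- **NEAR A CENTRE, FORM CURRENCY** — the carrier for gauge-covariant actions (PRICING-NE7b v103 R-HCT-g82-1: the floor is asked of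
the PULLED-BACK form only, i.e. on `range Dφ(x)`): `2·Q(w) ≤ D²V(y)[w, w]` and `‖D²V(y)‖ ≤ L` on `K`, `‖DV(y₀)‖ ≤ g₀`, `φ(K') ⊆ K ∩ B̄(y₀, r)`,
`‖D²φ‖ ≤ q` on `K'` ⟹ `2·Q(Dφ(x)v) − (g₀ + L·r)·q·‖v‖² ≤ D²(V ∘ φ)(x)[v, v]` on `K'`. [folklore] -/
theorem hessianOn_comp_lower_near_of_form {V : F → ℝ} {φ : E → F} {K : Set F} {K' : Set E} (hK : Convex ℝ K) (hφK : MapsTo φ K' K)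
    (hV : ∀ y ∈ K, ContDiffAt ℝ 2 V y) (hφ : ∀ x ∈ K', ContDiffAt ℝ 2 φ x) {y₀ : F} (hy₀ : y₀ ∈ K) (Q : F → ℝ) {L q r g₀ : ℝ}
    (hg₀ : ‖fderiv ℝ V y₀‖ ≤ g₀) (hH : ∀ y ∈ K, ∀ w : F, 2 * Q w ≤ iteratedFDeriv ℝ 2 V y ![w, w])
    (hL : ∀ y ∈ K, ‖iteratedFDeriv ℝ 2 V y‖ ≤ L) (hq : ∀ x ∈ K', ‖iteratedFDeriv ℝ 2 φ x‖ ≤ q) (hr : ∀ x ∈ K', ‖φ x - y₀‖ ≤ r) :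
    ∀ x ∈ K', ∀ v : E, 2 * Q (fderiv ℝ φ x v) - (g₀ + L * r) * q * ‖v‖ ^ 2 ≤ iteratedFDeriv ℝ 2 (V ∘ φ) x ![v, v] := by
  have hL0 : 0 ≤ L := (norm_nonneg _).trans (hL y₀ hy₀)
  have hg : ∀ x ∈ K', ‖fderiv ℝ V (φ x)‖ ≤ g₀ + L * r := fun x hx =>
    (norm_fderiv_le_of_norm_iteratedFDeriv_two_le hK hV hL hy₀ (hφK hx)).trans (add_le_add hg₀ (mul_le_mul_of_nonneg_left (hr x hx) hL0))
  intro x hx v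
  have h := hessianOn_comp_lower_of_form hφK (fun x hx => hV (φ x) (hφK hx)) hφ Q hH hg hq x hx v
  linarith

end NearMinimiser

/-! ## §7 Toy check (kernel): the letters `λμ² − g·q` are attained -/

/-- Toy (one variable): `V y = (λ∕2)y² + g·y` has modulus `λ` and gradient `g` at `0`; the chart `φ t = μt − (q∕2)t²` has `φ 0 = 0`,
`φ′(0) = μ`, `φ″ = −q`.  The composed exponent `V(φ t)` has `t²`-coefficient `(λμ² − g·q)∕2`, i.e. second derivative EXACTLY
`λμ² − g·q` at `t = 0`: the lower letter of §2 is sharp. -/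
example (lam μ g q t : ℝ) :
    lam / 2 * (μ * t - q / 2 * t ^ 2) ^ 2 + g * (μ * t - q / 2 * t ^ 2) =
      g * μ * t + (lam * μ ^ 2 - g * q) / 2 * t ^ 2 - lam * μ * q / 2 * t ^ 3 + lam * q ^ 2 / 8 * t ^ 4 := by
  ring

end Summit.QuantumFields.BalabanUV.T4Continuum.NE7b.HessianChartTransport
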